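import Literature.AnabelianGeometry.EtaleTheta.Discharge.Sec3Cor38StdIsoNotGL
import Literature.AnabelianGeometry.EtaleTheta.Discharge.Sec3Thm37Holds
import Literature.AlgebraicGeometry.Frobenioids.Cor411iiAssemblyFSM
import HarnessLib

/-!
# [EtTh] Cor 3.8, proof row C38-L04 case (ii): the base squares of [FrdI] Cor 4.11 (ii) for `Ψ`, `Ψ⁻¹` —
# DISCHARGED at the canonical [FrdI] vocabulary over bases of FSM-type (FACT-LIST rows F-2813, F-2814)

S. Mochizuki, *The étale theta function and its Frobenioid-theoretic manifestations*, Publ. RIMS **45** (2009)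
[MochizukiEtTh2009], Cor. 3.8 "Preservation of Base-field-theoretic Morphisms and Hulls", proof, PDF p.81 l.5–8
(printed 307): "By applying … [Mzk17], Theorem 3.4, (ii); [Mzk17], Corollary 4.11, (ii), in the case of assertion (ii),
it follows that `Ψ` preserves the submonoids '`O^▷(−)`'" [cite: MochizukiEtTh2009, Cor 3.8 p.81]; S. Mochizuki,
*The geometry of Frobenioids I*, Kyushu J. Math. **62** (2008), Cor. 4.11 (ii) p.91 ("there exists a 1-unique functor
`Ψ^Base : D₁ → D₂` …") [cite: MochizukiFrdI2008, Cor. 4.11 (ii) p.91], Thm. 3.4 (iii) hypothesis (b) p.62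
[cite: MochizukiFrdI2008, Thm. 3.4 (iii) p.62].

PROOF-ONLY companion (cell abc-iut, seat abc-iut-f-001, F fact-proving wave, tranche 134 of `plan/F-TRANCHES.tsv`)
of the FROZEN statements-first sub-DAG `TemperedFrobenioidCor38Sub.lean` (seat abc-iut-w5-d124, p414329), rows
**F-2813** `Cor38Hyp.BaseSquare` and **F-2814** `Cor38Hyp.BaseSquareInv` (the conclusion of [FrdI] Cor. 4.11 (ii) for
`Ψ` and for `Ψ⁻¹`).  That file PROVED both rows from `C₁.opsData.Cor411ii C₂.opsData h.Ψ` taken as a BINDER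
(`baseSquare_of_cor411ii`, `baseSquareInv_of_cor411ii`).  The binder is a THEOREM of the tree for every pair of
Frobenioids with perf-factorial divisor monoids over bases of FSM-type (`PreFrobenioid.cor411ii_ofFunctor_of_isOfFSMType`,
abc-iut-L1 lineage, the amended route through `C^un-tr`), and the Frobenioid `C_i` of a tempered Frobenioid IS a
Frobenioid at the canonical vocabulary `treeCatVocab` (`TemperedFrobenioid.isFrobenioid_treeCatVocab_of_isMonoidOn`,
[FrdI] Thm. 5.2 (ii)) modulo the single standing residual of the L2 board `hBmon_i : IsMonoidOn C_i.ratFnFunctor`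
("`𝔹` a monoid on `D`", [FrdI] Thm. 5.2 preamble).  Hence:

* `Cor38Hyp.hypB` / `hypB_symm` (ANY vocabulary, unconditional) — hypothesis (b) of [FrdI] Thm. 3.4 (iii) / of the
  Cor. 4.11 setting is VACUOUS for tempered Frobenioids ("not of group-like type", Thm. 3.7 (i),
  `opsData_not_isOfGroupLikeType`);
* `TemperedFrobenioid.isPerfFactorial_divisorMonoid_treeVocab` — "`Φ` perf-factorial" objectwise, the field
  `isPerfFactorial` read at `treeMonoidVocab` (bookkeeping);
* `Cor38Hyp.cor411ii_treeCatVocab_of_isOfFSMType` — the typed [FrdI] Cor. 4.11 (ii) for `Ψ` at the canonical vocabulary,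
  GIVEN `D₁`, `D₂` of FSM-type, modulo `hBmon₁`, `hBmon₂`;
* **`Cor38Hyp.baseSquare_treeCatVocab_of_isOfFSMType`** (row F-2813) and **`baseSquareInv_treeCatVocab_of_isOfFSMType`**
  (row F-2814): for `D₁`, `D₂` Div-slim (the hypothesis of Cor. 3.8 (ii)) and of FSM-type, the `1`-unique base
  equivalences `Ψ^Base`, `(Ψ⁻¹)^Base` exist — with row C38-L01 ("standard, isotropic, not group-like") discharged at the
  canonical vocabulary by abc-iut-w5-d135 (`standardIsotropicNotGroupLike_treeCatVocab`); modulo `hBmon₁`, `hBmon₂`.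

HONEST LABEL: the tree's Cor. 4.11 (ii) is proved over bases of FSM-type (FSM-type ⟹ FSMFF-type,
`IsOfFSMType.isOfFSMFFType`; Cor. 3.8 itself assumes only FSMFF-type), so the FSM-type hypotheses `hD`, `hD'` are
displayed; the rows are proved AT THE CANONICAL VOCABULARY (plan rule R5: the instance form the Cor. 3.8 (ii) knit
`cor38_ii_of_rows` consumes), modulo `hBmon_i`.  Refereed pre-IUT material; nothing of either paper is restated or
strengthened; no definition; nothing here bears on [IUTchIII] Cor. 3.12; typed ≠ proved elsewhere.
-/

namespace Literature.AnabelianGeometry.EtaleTheta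

open CategoryTheory Opposite Literature.AlgebraicGeometry.Frobenioids

universe u₀ v₀ u v w

namespace Cor38Hyp

/-! ## Over any vocabulary: hypothesis (b) of [FrdI] Thm 3.4 (iii) is vacuous -/

section AnyVocab

variable {D₀ : Type u₀} [Category.{v₀} D₀] {D₀' : Type u₀} [Category.{v₀} D₀'] {V : FrdIMonoidStub.{w}}
  {T : RealifiedDivisorMonoids (D₀ := D₀) V} {T' : RealifiedDivisorMonoids (D₀ := D₀') V}
  {D : Type u} [Category.{v} D] {D' : Type u} [Category.{v} D']
  {VD : FrdICatStub.{u, v, w} D} {VD' : FrdICatStub.{u, v, w} D'}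
  {C₁ : TemperedFrobenioid T D VD} {C₂ : TemperedFrobenioid T' D' VD'} (h : Cor38Hyp C₁ C₂)

/-- Hypothesis (b) of [FrdI] Thm. 3.4 (iii) ("if `C₁, C₂` are of group-like type, then …") holds VACUOUSLY for the
Frobenioids of two tempered Frobenioids: `C₁` is not of group-like type (Thm. 3.7 (i), `Φ` is not the zero monoid).
[cite: MochizukiEtTh2009, Thm 3.7 (i) p.79] -/
theorem hypB : C₁.opsData.HypB C₂.opsData h.Ψ :=
  fun h₁ _ => absurd h₁ C₁.opsData_not_isOfGroupLikeType

/-- Hypothesis (b) of [FrdI] Thm. 3.4 (iii) for `Ψ⁻¹`, likewise vacuous. [cite: MochizukiEtTh2009, Thm 3.7 (i) p.79] -/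
theorem hypB_symm : C₂.opsData.HypB C₁.opsData h.Ψ.symm :=
  fun h₂ _ => absurd h₂ C₂.opsData_not_isOfGroupLikeType

end AnyVocab

/-! ## "`Φ` perf-factorial" at the canonical monoid vocabulary -/

section PerfFactorial

variable {D₀ : Type u₀} [Category.{v₀} D₀] {T : RealifiedDivisorMonoids (D₀ := D₀) treeMonoidVocab.{w}}
  {D : Type u} [Category.{v} D] {VD : FrdICatStub.{u, v, w} D}

/-- "`Φ` perf-factorial" ([FrdI] Def. 2.4 (i)), objectwise for the divisor monoid of a tempered Frobenioid at the
canonical monoid vocabulary: the field `isPerfFactorial` read through `treeMonoidVocab` (bookkeeping).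
[cite: MochizukiEtTh2009, Def 3.6 p.77] -/
theorem _root_.Literature.AnabelianGeometry.EtaleTheta.TemperedFrobenioid.isPerfFactorial_divisorMonoid_treeVocab
    (C : TemperedFrobenioid T D VD) : Objectwise (fun M _ => IsPerfFactorial M) C.divisorMonoid :=
  fun A => C.isPerfFactorial (op A)

end PerfFactorial

/-! ## The base squares at the canonical [FrdI] vocabulary, modulo `hBmon₁`, `hBmon₂` -/

section TreeVocab

variable {D₀ : Type u₀} [Category.{v₀} D₀] {D₀' : Type u₀} [Category.{v₀} D₀']
  {T : RealifiedDivisorMonoids (D₀ := D₀) treeMonoidVocab.{w}}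
  {T' : RealifiedDivisorMonoids (D₀ := D₀') treeMonoidVocab.{w}}
  {D : Type u} [Category.{v} D] {D' : Type u} [Category.{v} D']
  {IsRational IsStrictlyRational : (Dᵒᵖ ⥤ CommMonCat.{w}) → Prop}
  {IsRational' IsStrictlyRational' : (D'ᵒᵖ ⥤ CommMonCat.{w}) → Prop}
  {C₁ : TemperedFrobenioid T D (treeCatVocab D IsRational IsStrictlyRational)}
  {C₂ : TemperedFrobenioid T' D' (treeCatVocab D' IsRational' IsStrictlyRational')}
  (h : Cor38Hyp C₁ C₂)

/-- The [FrdI] Cor. 4.11 (ii) conclusion for `Ψ` at the canonical vocabulary, GIVEN bases of FSM-type: the tree's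
Cor. 4.11 (ii) (`PreFrobenioid.cor411ii_ofFunctor_of_isOfFSMType`) for the Frobenioids `C₁`, `C₂` with perf-factorial
`Φ_i`; modulo `hBmon₁`, `hBmon₂`. [cite: MochizukiFrdI2008, Cor. 4.11 (ii) p.91] -/
theorem cor411ii_treeCatVocab_of_isOfFSMType (hBmon₁ : IsMonoidOn C₁.ratFnFunctor)
    (hBmon₂ : IsMonoidOn C₂.ratFnFunctor) (hD : IsOfFSMType D) (hD' : IsOfFSMType D') :
    C₁.opsData.Cor411ii C₂.opsData h.Ψ :=
  PreFrobenioid.cor411ii_ofFunctor_of_isOfFSMType (C₁.isFrobenioid_treeCatVocab_of_isMonoidOn hBmon₁)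
    (C₂.isFrobenioid_treeCatVocab_of_isMonoidOn hBmon₂) h.Ψ C₁.isPerfFactorial_divisorMonoid_treeVocab
    C₂.isPerfFactorial_divisorMonoid_treeVocab hD hD'

/-- **Row F-2813 DISCHARGED at the canonical vocabulary over bases of FSM-type** (case (ii) of C38-L04, p.81:
"[Mzk17], Corollary 4.11, (ii)"): for `D₁`, `D₂` Div-slim (the hypothesis of Cor. 3.8 (ii)) and of FSM-type, there is a
`1`-unique `Ψ^Base : D₁ → D₂` under `Ψ` — [FrdI] Cor. 4.11 (ii) (`cor411ii_treeCatVocab_of_isOfFSMType`) in the setting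
(Div-slim, C38-L01, (b) vacuous); modulo `hBmon₁`, `hBmon₂`. [cite: MochizukiEtTh2009, Cor 3.8 p.81] -/
theorem baseSquare_treeCatVocab_of_isOfFSMType (hBmon₁ : IsMonoidOn C₁.ratFnFunctor)
    (hBmon₂ : IsMonoidOn C₂.ratFnFunctor) (hD : IsOfFSMType D) (hD' : IsOfFSMType D')
    (hds : C₁.opsData.IsDivSlim ∧ C₂.opsData.IsDivSlim) : h.BaseSquare :=
  h.baseSquare_of_cor411ii (h.cor411ii_treeCatVocab_of_isOfFSMType hBmon₁ hBmon₂ hD hD') hds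
    (h.standardIsotropicNotGroupLike_treeCatVocab hBmon₁ hBmon₂) h.hypB

/-- **Row F-2814 DISCHARGED at the canonical vocabulary over bases of FSM-type**: the `1`-unique `(Ψ⁻¹)^Base : D₂ → D₁`
under `Ψ⁻¹`, for `D₁`, `D₂` Div-slim and of FSM-type — [FrdI] Cor. 4.11 (ii) applied to `Ψ⁻¹`; modulo `hBmon₁`,
`hBmon₂`. [cite: MochizukiEtTh2009, Cor 3.8 p.81] -/
theorem baseSquareInv_treeCatVocab_of_isOfFSMType (hBmon₁ : IsMonoidOn C₁.ratFnFunctor)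
    (hBmon₂ : IsMonoidOn C₂.ratFnFunctor) (hD : IsOfFSMType D) (hD' : IsOfFSMType D')
    (hds : C₁.opsData.IsDivSlim ∧ C₂.opsData.IsDivSlim) : h.BaseSquareInv :=
  h.baseSquareInv_of_cor411ii
    (PreFrobenioid.cor411ii_ofFunctor_of_isOfFSMType (C₂.isFrobenioid_treeCatVocab_of_isMonoidOn hBmon₂)
      (C₁.isFrobenioid_treeCatVocab_of_isMonoidOn hBmon₁) h.Ψ.symm C₂.isPerfFactorial_divisorMonoid_treeVocab
      C₁.isPerfFactorial_divisorMonoid_treeVocab hD' hD)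
    hds (h.standardIsotropicNotGroupLike_treeCatVocab hBmon₁ hBmon₂) h.hypB_symm

end TreeVocab

end Cor38Hyp

end Literature.AnabelianGeometry.EtaleTheta
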